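import Summits.BirchSwinnertonDyer.BirchSwinnertonDyer.Theorems.CumulativeHeegnerLeopoldtCumulativeHeegnerInclusionAtThreeLineBaseChange
import Summits.BirchSwinnertonDyer.BirchSwinnertonDyer.Theorems.CumulativeHeegnerLeopoldtCumulativeHeegnerInclusionAtThreeStubLineDeterminantAtThree
import Summits.BirchSwinnertonDyer.Rank1Residual.Additive.PotSupersingularClasses
import Summits.BirchSwinnertonDyer.Rank1Residual.X11b.AnticyclotomicLocalTowerTorsion
import Literature.NumberTheory.EllipticCurves.AnticyclotomicPrimeDecompositionAboveProofs
import Literature.NumberTheory.EllipticCurves.HeegnerPoints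
import Literature.NumberTheory.EllipticCurves.GeomPointsGaloisModule
import HarnessLib

/-!
# Crux K1 `CumulativeHeegnerInclusionAtThree` (stmt-BirchSwinnertonDyer-24198), line `birth` — a named
# input of STUB A on the Leopoldt cell: **no `3`-torsion over `K`, `K_{𝔭′}`, `K_∞`, `K_{∞,w}`**

Width seat bsd-line-chl-k1-p1-w2 (`--supports stmt-BirchSwinnertonDyer-24198`). STUB A (the tempered
inclusion) cites «the Kolyvagin-system bound WITH `E(K)[3] = 0`», and every control / rigidity step on the
anticyclotomic tower consumes `E(K_∞)[3^∞] = 0` / `E(K_{∞,w})[3^∞] = 0` (Castella 2018 erratum Thm. 1.1 (iv),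
Greenberg LNM 1716 Prop. 4.8, Perrin-Riou's «no `Λ`-torsion in `H¹`»). On the crux's cell these are THEOREMS,
proved here from the NON-ANOMALOUS clause alone (no reduction-type input beyond `3 ∣ N` for the splitting of `3`):

* §1 `eq_zero_of_fixed_of_natCard_eq` — a group of prime order on which `D` acts non-trivially has no
  non-zero `D`-fixed element; §1 `geomTorsion_eq_zero_of_fixed_of_line` — dévissage along a stable line
  `S ≤ E[p]`: if `D` acts non-trivially on `S` and on `E[p]/S`, then `E[p]^D = 0`.
* §2 on the cell (`E/ℚ` of class O6 at `3`, rational line `Φ ≤ E[3]` non-anomalous at `3`, `K` Heegner for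
  `N = N_E`, `𝔭′ ∋ 3`): `cell_geomTorsion_eq_zero_of_fixed_decomp` (`E(K_{𝔭′})[3] = 0` along the chosen
  embedding: `E_K[3]^{D_{𝔭′}} = 0`), `cell_fixedPoints_decomp_inf_kerSubgroup_eq_bot`
  (`E(K_{∞,w})[3^∞] = 0`: `E_K[3^∞]^{D_{𝔭′} ⊓ ker κ} = ⊥` for EVERY `ℤ₃`-extension `κ`, by the tree's pro-`3`
  principle `X11b.AcSelmer.fixedPoints_decomp_inf_kerSubgroup_eq_bot`), `cell_fixedPoints_kerSubgroup_eq_bot`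
  (`E(K_∞)[3^∞] = 0`) and `cell_geomPrimaryTorsion_eq_zero_of_fixed` (`E(K)[3^∞] = 0`).
The line over `K` and the transport of the clause to `D_{𝔭′}` are the lead's `…LineBaseChange` (p611257).
THEOREMS ONLY; no definition, no `sorry`; imports no `Theses` module. BSD is not proved by any of this.
References: [Castella2018Erratum] Thm. 1.1 (iv), Lemma 2.1; [GreenbergLNM1716] §3 Lemma 3.1, Prop. 4.8;
[GreenbergVatsal2000] §2 p. 28; [SerreGaloisCohomology1997] I §1.4.
-/

set_option autoImplicit false
-- `…BirchSwinnertonDyer.BirchSwinnertonDyer.Theorems…` is the problem's mandated namespace (D-0017).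
set_option linter.dupNamespace false

noncomputable section

open scoped Classical

namespace Summit.BirchSwinnertonDyer.BirchSwinnertonDyer.Theorems.CumulativeHeegnerInclusionAtThreeCellNoThreeTorsion

open NumberField IsDedekindDomain Field WeierstrassCurve
open Literature.NumberTheory.EllipticCurves Literature.NumberTheory.EllipticCurves.GreenbergSelmer
  Literature.NumberTheory.GaloisRepresentations IsDedekindDomain.HeightOneSpectrum
  Literature.NumberTheory.EllipticCurves.Rank1Residual
  Summit.BirchSwinnertonDyer.Rank1Residual.X11b Summit.BirchSwinnertonDyer.Rank1Residual.X11b.AcSelmer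
  Summit.BirchSwinnertonDyer.Rank1Residual.X2.ResidualDevissageModules
  Summit.BirchSwinnertonDyer.BirchSwinnertonDyer.Theorems.CumulativeHeegnerInclusionAtThreeLineBaseChange
  Summit.BirchSwinnertonDyer.BirchSwinnertonDyer.Theorems.CumulativeHeegnerInclusionAtThreeStubLineDeterminantAtThree
  Summit.BirchSwinnertonDyer.BirchSwinnertonDyer.Theorems.AdditiveKoly.SplitCompletion

/-! ### §1 Fixed vectors: prime order, and dévissage along a stable line -/

/-- **A group of prime order on which `D` acts non-trivially has no non-zero `D`-fixed element** (a non-zero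
element generates). [cite: GreenbergVatsal2000, §2 p. 28] -/
theorem eq_zero_of_fixed_of_natCard_eq {G A : Type*} [Group G] [AddCommGroup A] [DistribMulAction G A]
    {p : ℕ} [hp : Fact p.Prime] (hA : Nat.card A = p) (D : Subgroup G)
    (hnon : ¬ ∀ g ∈ D, ∀ a : A, g • a = a) (y : A) (hy : ∀ g ∈ D, g • y = y) : y = 0 := by
  by_contra hy0
  apply hnon
  intro g hg a
  have hpr : p.Prime := hp.out
  haveI : Finite A := Nat.finite_of_card_ne_zero (by rw [hA]; exact hpr.ne_zero)
  have hord : addOrderOf y = p := by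
    have hdvd : addOrderOf y ∣ Nat.card A := addOrderOf_dvd_natCard y
    rw [hA] at hdvd
    rcases (Nat.dvd_prime hpr).mp hdvd with h1 | h1
    · exact absurd (AddMonoid.addOrderOf_eq_one_iff.mp h1) hy0
    · exact h1
  have htop : AddSubgroup.zmultiples y = ⊤ := by
    apply AddSubgroup.eq_top_of_card_eq
    rw [Nat.card_zmultiples, hord, hA]
  have ha : a ∈ AddSubgroup.zmultiples y := by rw [htop]; exact AddSubgroup.mem_top a
  obtain ⟨k, rfl⟩ := AddSubgroup.mem_zmultiples_iff.mp ha
  rw [smul_comm g k y, hy g hg]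

/-- **Dévissage of fixed vectors along a stable line.** `S ≤ E[p]` a `Γ_K`-stable line of order `p`,
`D ≤ Γ_K` acting non-trivially on `S` and on `E[p]/S`: then `E[p]` has no non-zero `D`-fixed point.
[cite: GreenbergVatsal2000, §2 p. 28] [cite: GreenbergLNM1716, §3 Lemma 3.1] -/
theorem geomTorsion_eq_zero_of_fixed_of_line {K : Type} [Field K] [NumberField K] (X : WeierstrassCurve K)
    [X.IsElliptic] (p : ℕ) [Fact p.Prime]
    (S : StableSubgroup (absoluteGaloisGroup K) (X.geomTorsion (p : ℤ))) (hS : Nat.card S.Sub = p)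
    (D : Subgroup (absoluteGaloisGroup K))
    (h1 : ¬ ∀ g ∈ D, ∀ x : S.Sub, g • x = x) (h2 : ¬ ∀ g ∈ D, ∀ y : S.Quot, g • y = y)
    (P : X.geomTorsion (p : ℤ)) (hP : ∀ g ∈ D, g • P = P) : P = 0 := by
  have hQuot : Nat.card S.Quot = p := natCard_quot_eq X p S hS
  -- the image in the quotient is fixed, hence zero
  have hproj : S.proj P = 0 :=
    eq_zero_of_fixed_of_natCard_eq hQuot D h2 (S.proj P) fun g hg ↦ by rw [S.smul_proj, hP g hg]
  have hmem : P ∈ S.toAddSubgroup := by rw [← S.ker_proj, AddMonoidHom.mem_ker]; exact hproj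
  rw [← S.range_incl] at hmem
  obtain ⟨x, hx⟩ := hmem
  -- the element of the line is fixed, hence zero
  have hx0 : x = 0 :=
    eq_zero_of_fixed_of_natCard_eq hS D h1 x fun g hg ↦
      S.incl_injective (by rw [S.incl_smul, hx, hP g hg])
  rw [← hx, hx0, map_zero]

/-! ### §2 The Leopoldt cell of crux K1 -/

/-- **`E(K_{𝔭′})[3] = 0` on the cell** (along the chosen embedding): no non-zero point of `E_K[3]` is fixed
by the decomposition group `D_{𝔭′}`, for every prime `𝔭′ ∋ 3` of the Heegner field `K`. Proof: `3 ∣ N`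
(class O6 is additive at `3`) splits in `K`, so `𝔭′` has degree one and the non-anomalous clause at the primes
of `\bar ℚ` above `3` transports to «`D_{𝔭′}` acts non-trivially on the line `Φ_K` and on `E_K[3]/Φ_K`»
(`…LineBaseChange`); then §1. [cite: GreenbergVatsal2000, §2 p. 28] [cite: Castella2018Erratum, Thm. 1.1 (iv)] -/
theorem cell_geomTorsion_eq_zero_of_fixed_decomp :
    ∀ (W : WeierstrassCurve ℚ) [W.IsElliptic] [W.IsGloballyMinimal] (N : ℕ) [NeZero N] (K : Type) [Field K]
      [NumberField K], Summit.BirchSwinnertonDyer.Rank1Residual.Additive.ClassO6 W 3 →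
      (∃ Φ : AddSubgroup (WeierstrassCurve.geomTorsion W ((3 : ℕ) : ℤ)),
        Literature.NumberTheory.EllipticCurves.Rank1Residual.IsRationalLine W 3 Φ ∧
        ∀ (v : IsDedekindDomain.HeightOneSpectrum (NumberField.RingOfIntegers ℚ)),
          ((3 : ℕ) : NumberField.RingOfIntegers ℚ) ∈ v.asIdeal → ∀ 𝔓 ∈ v.primesAbove,
          ¬ (∀ g ∈ 𝔓.decompositionSubgroup (Field.absoluteGaloisGroup ℚ), ∀ P ∈ Φ, g • P = P) ∧
          ¬ (∀ g ∈ 𝔓.decompositionSubgroup (Field.absoluteGaloisGroup ℚ),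
              ∀ P : WeierstrassCurve.geomTorsion W ((3 : ℕ) : ℤ), g • P - P ∈ Φ)) →
      W.conductorNorm ℤ = N → Literature.NumberTheory.EllipticCurves.IsImaginaryQuadratic K →
      Literature.NumberTheory.EllipticCurves.SatisfiesHeegnerHypothesis N K →
      ∀ (𝔭' : IsDedekindDomain.HeightOneSpectrum (NumberField.RingOfIntegers K)),
        ((3 : ℕ) : NumberField.RingOfIntegers K) ∈ 𝔭'.asIdeal →
      ∀ P : (W.baseChange K).geomTorsion ((3 : ℕ) : ℤ), (∀ g ∈ decomp 𝔭', g • P = P) → P = 0 := by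
  intro W _ _ N _ K _ _ hO6 hline hN hK hHg 𝔭' h𝔭' P hP
  obtain ⟨Φ, hΦ, hcell⟩ := hline
  haveI : Fact (Nat.Prime 3) := ⟨Nat.prime_three⟩
  haveI hEK : (W.baseChange K).IsElliptic := inferInstanceAs (W.map (algebraMap ℚ K)).IsElliptic
  haveI : IsGalois ℚ K := isGalois_of_finrank_eq_two K hK.1
  -- `3 ∣ N` splits in `K`: `𝔭′` has degree one
  have h3N : 3 ∣ N := by
    rw [← hN]
    exact (W.dvd_conductorNorm_iff_not_hasGoodReductionAtPrime 3).mpr hO6.2.1.1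
  have hsplit : ((Ideal.span {((3 : ℕ) : ℤ)}).primesOver (𝓞 K)).ncard = 2 := hHg 3 Nat.prime_three h3N
  have he : 𝔭'.asIdeal.ramificationIdx (𝓞 ℚ) = 1 :=
    ramificationIdx_eq_one_of_card_primesOver K 3 hK.1 hsplit 𝔭' h𝔭'
  have hf : 𝔭'.asIdeal.inertiaDeg (𝓞 ℚ) = 1 :=
    inertiaDeg_eq_one_of_card_primesOver K 3 hK.1 hsplit 𝔭' h𝔭'
  set v₃ : HeightOneSpectrum (𝓞 ℚ) := 𝔭'.under (𝓞 ℚ) with hv₃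
  have hw : 𝔭'.asIdeal.under (𝓞 ℚ) = v₃.asIdeal := by rw [hv₃, HeightOneSpectrum.under_asIdeal]
  have h3v : ((3 : ℕ) : 𝓞 ℚ) ∈ v₃.asIdeal := natCast_mem_under K 3 𝔭' h𝔭'
  have hcellv := hcell v₃ h3v
  -- the line over `K`
  obtain ⟨t, ht⟩ := exists_geomTorsion_baseChange_equiv W K ((3 : ℕ) : ℤ)
  have ht' : ∀ (σ : absoluteGaloisGroup K) (Q : W.geomTorsion ((3 : ℕ) : ℤ)),
      t (absGaloisRestrict ℚ K σ • Q) = σ • t Q := fun σ Q ↦ by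
    rw [← resGal_eq_absGaloisRestrict]; exact ht σ Q
  obtain ⟨S, hS, hcardS⟩ := exists_stableSubgroup_corr Φ t ht' hΦ.2
  have hSub : Nat.card S.Sub = 3 := by rw [hcardS, hΦ.1]
  -- the non-anomalous clause on `decomp 𝔭′`
  have hnon1 : ¬ ∀ γ ∈ decomp 𝔭', ∀ x : S.Sub, γ • x = x :=
    not_forall_decomp_smul_sub_eq_of_corr Φ t ht' S hS
      (not_forall_decomp_smul_eq K Φ hw he hf fun 𝔓 h𝔓 ↦ (hcellv 𝔓 h𝔓).1)
  have hnon2 : ¬ ∀ γ ∈ decomp 𝔭', ∀ y : S.Quot, γ • y = y :=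
    not_forall_decomp_smul_quot_eq_of_corr Φ t ht' S hS
      (not_forall_decomp_smul_sub_mem K Φ hw he hf fun 𝔓 h𝔓 ↦ (hcellv 𝔓 h𝔓).2)
  exact geomTorsion_eq_zero_of_fixed_of_line (W.baseChange K) 3 S hSub (decomp 𝔭') hnon1 hnon2 P hP

/-- **`E(K_{∞,w})[3^∞] = 0` on the cell, for EVERY `ℤ₃`-extension `κ` of `K`**: the subgroup of `E_K[3^∞]`
fixed by `D_{𝔭′} ⊓ ker κ` (the absolute Galois group of the completion of `K_∞ = \bar K^{ker κ}` at the chosen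
place above `𝔭′`) is trivial — `E(K_{𝔭′})[3] = 0` (previous theorem) fed to the tree's pro-`3` fixed-point
principle `X11b.AcSelmer.fixedPoints_decomp_inf_kerSubgroup_eq_bot`. This is hypothesis (iv) of Castella's
erratum / the vanishing local term at `𝔭′` of anticyclotomic control on the Leopoldt cell.
[cite: Castella2018Erratum, Thm. 1.1 (iv) and Lemma 2.1 (pp. 1–2)] [cite: GreenbergLNM1716, proof of Prop. 4.8 (p. 109)] -/
theorem cell_fixedPoints_decomp_inf_kerSubgroup_eq_bot :
    ∀ (W : WeierstrassCurve ℚ) [W.IsElliptic] [W.IsGloballyMinimal] (N : ℕ) [NeZero N] (K : Type) [Field K]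
      [NumberField K], Summit.BirchSwinnertonDyer.Rank1Residual.Additive.ClassO6 W 3 →
      (∃ Φ : AddSubgroup (WeierstrassCurve.geomTorsion W ((3 : ℕ) : ℤ)),
        Literature.NumberTheory.EllipticCurves.Rank1Residual.IsRationalLine W 3 Φ ∧
        ∀ (v : IsDedekindDomain.HeightOneSpectrum (NumberField.RingOfIntegers ℚ)),
          ((3 : ℕ) : NumberField.RingOfIntegers ℚ) ∈ v.asIdeal → ∀ 𝔓 ∈ v.primesAbove,
          ¬ (∀ g ∈ 𝔓.decompositionSubgroup (Field.absoluteGaloisGroup ℚ), ∀ P ∈ Φ, g • P = P) ∧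
          ¬ (∀ g ∈ 𝔓.decompositionSubgroup (Field.absoluteGaloisGroup ℚ),
              ∀ P : WeierstrassCurve.geomTorsion W ((3 : ℕ) : ℤ), g • P - P ∈ Φ)) →
      W.conductorNorm ℤ = N → Literature.NumberTheory.EllipticCurves.IsImaginaryQuadratic K →
      Literature.NumberTheory.EllipticCurves.SatisfiesHeegnerHypothesis N K →
      ∀ (κ : Literature.NumberTheory.EllipticCurves.ZpExtension K 3)
        (𝔭' : IsDedekindDomain.HeightOneSpectrum (NumberField.RingOfIntegers K)),
        ((3 : ℕ) : NumberField.RingOfIntegers K) ∈ 𝔭'.asIdeal →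
      haveI : (W.baseChange K).IsElliptic := inferInstanceAs (W.map (algebraMap ℚ K)).IsElliptic
      FixedPoints.addSubgroup ↥(decomp 𝔭' ⊓ κ.kerSubgroup) ((W.baseChange K).geomPrimaryTorsion 3) = ⊥ := by
  intro W _ _ N _ K _ _ hO6 hline hN hK hHg κ 𝔭' h𝔭'
  haveI : Fact (Nat.Prime 3) := ⟨Nat.prime_three⟩
  haveI hEK : (W.baseChange K).IsElliptic := inferInstanceAs (W.map (algebraMap ℚ K)).IsElliptic
  have h0 := cell_geomTorsion_eq_zero_of_fixed_decomp W N K hO6 hline hN hK hHg 𝔭' h𝔭'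
  refine AcSelmer.fixedPoints_decomp_inf_kerSubgroup_eq_bot κ (W.baseChange K) 𝔭' fun m hfix hpm ↦ ?_
  -- `m ∈ E[3^∞]` with `3 • m = 0` is a point of `E[3]`, fixed by `D_{𝔭′}`
  have hmem : ((m : (W.baseChange K).geomPrimaryTorsion 3) : geomPoints (W.baseChange K)) ∈
      (W.baseChange K).geomTorsion ((3 : ℕ) : ℤ) :=
    AddSubgroup.torsionBy.nsmul_iff.mpr (by rw [← AddSubgroupClass.coe_nsmul, hpm, ZeroMemClass.coe_zero])
  have hP0 : (⟨_, hmem⟩ : (W.baseChange K).geomTorsion ((3 : ℕ) : ℤ)) = 0 := by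
    refine h0 _ fun g hg ↦ Subtype.ext ?_
    change g • ((m : (W.baseChange K).geomPrimaryTorsion 3) : geomPoints (W.baseChange K)) =
      ((m : (W.baseChange K).geomPrimaryTorsion 3) : geomPoints (W.baseChange K))
    rw [← primaryComponent.coe_smul, hfix g hg]
  have hval : ((m : (W.baseChange K).geomPrimaryTorsion 3) : geomPoints (W.baseChange K)) = 0 :=
    congrArg Subtype.val hP0
  exact Subtype.ext hval

/-- **`E(K_∞)[3^∞] = 0` on the cell, for EVERY `ℤ₃`-extension `κ` of `K`**: the subgroup of `E_K[3^∞]` fixed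
by `Gal(\bar K/K_∞) = ker κ` is trivial (a point fixed by `ker κ` is fixed by `D_{𝔭′} ⊓ ker κ` for a prime
`𝔭′ ∋ 3`, which exists since `3` splits in `K`). The form consumed by Perrin-Riou's «no `Λ`-torsion in
`H¹(K, T^{ac})`» and by Howard-type Kolyvagin-system arguments. [cite: Castella2018Erratum, Lemma 2.1 (pp. 1–2)] [cite: GreenbergLNM1716, §3 Lemma 3.1] -/
theorem cell_fixedPoints_kerSubgroup_eq_bot :
    ∀ (W : WeierstrassCurve ℚ) [W.IsElliptic] [W.IsGloballyMinimal] (N : ℕ) [NeZero N] (K : Type) [Field K]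
      [NumberField K], Summit.BirchSwinnertonDyer.Rank1Residual.Additive.ClassO6 W 3 →
      (∃ Φ : AddSubgroup (WeierstrassCurve.geomTorsion W ((3 : ℕ) : ℤ)),
        Literature.NumberTheory.EllipticCurves.Rank1Residual.IsRationalLine W 3 Φ ∧
        ∀ (v : IsDedekindDomain.HeightOneSpectrum (NumberField.RingOfIntegers ℚ)),
          ((3 : ℕ) : NumberField.RingOfIntegers ℚ) ∈ v.asIdeal → ∀ 𝔓 ∈ v.primesAbove,
          ¬ (∀ g ∈ 𝔓.decompositionSubgroup (Field.absoluteGaloisGroup ℚ), ∀ P ∈ Φ, g • P = P) ∧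
          ¬ (∀ g ∈ 𝔓.decompositionSubgroup (Field.absoluteGaloisGroup ℚ),
              ∀ P : WeierstrassCurve.geomTorsion W ((3 : ℕ) : ℤ), g • P - P ∈ Φ)) →
      W.conductorNorm ℤ = N → Literature.NumberTheory.EllipticCurves.IsImaginaryQuadratic K →
      Literature.NumberTheory.EllipticCurves.SatisfiesHeegnerHypothesis N K →
      ∀ (κ : Literature.NumberTheory.EllipticCurves.ZpExtension K 3),
      haveI : (W.baseChange K).IsElliptic := inferInstanceAs (W.map (algebraMap ℚ K)).IsElliptic
      FixedPoints.addSubgroup ↥κ.kerSubgroup ((W.baseChange K).geomPrimaryTorsion 3) = ⊥ := by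
  intro W _ _ N _ K _ _ hO6 hline hN hK hHg κ
  haveI : Fact (Nat.Prime 3) := ⟨Nat.prime_three⟩
  haveI hEK : (W.baseChange K).IsElliptic := inferInstanceAs (W.map (algebraMap ℚ K)).IsElliptic
  -- a prime `𝔭′ ∋ 3` of `K`
  have h3N : 3 ∣ N := by
    rw [← hN]
    exact (W.dvd_conductorNorm_iff_not_hasGoodReductionAtPrime 3).mpr hO6.2.1.1
  have hsplit : ((Ideal.span {((3 : ℕ) : ℤ)}).primesOver (𝓞 K)).ncard = 2 := hHg 3 Nat.prime_three h3N
  obtain ⟨Q, hQ⟩ := Set.nonempty_of_ncard_ne_zero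
    (s := (Ideal.span {((3 : ℕ) : ℤ)}).primesOver (𝓞 K)) (by rw [hsplit]; norm_num)
  haveI : Q.IsPrime := hQ.1
  haveI : Q.LiesOver (Ideal.span {((3 : ℕ) : ℤ)}) := hQ.2
  have h3Z : ((3 : ℕ) : ℤ) ∈ Q.under ℤ := by
    rw [← Ideal.LiesOver.over (p := Ideal.span {((3 : ℕ) : ℤ)}) (P := Q)]
    exact Ideal.mem_span_singleton_self _
  have h3Q : ((3 : ℕ) : 𝓞 K) ∈ Q := by
    have h := Ideal.mem_comap.mp h3Z
    rwa [map_natCast] at h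
  have hQne : Q ≠ ⊥ := fun hbot ↦ by
    rw [hbot, Ideal.mem_bot] at h3Q
    exact (by norm_num : ((3 : ℕ) : 𝓞 K) ≠ 0) h3Q
  set 𝔭' : HeightOneSpectrum (𝓞 K) := ⟨Q, hQ.1, hQne⟩ with h𝔭'def
  have h𝔭' : ((3 : ℕ) : 𝓞 K) ∈ 𝔭'.asIdeal := h3Q
  have h := cell_fixedPoints_decomp_inf_kerSubgroup_eq_bot W N K hO6 hline hN hK hHg κ 𝔭' h𝔭'
  rw [eq_bot_iff]
  intro m hm
  have hmem : m ∈ FixedPoints.addSubgroup ↥(decomp 𝔭' ⊓ κ.kerSubgroup)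
      ((W.baseChange K).geomPrimaryTorsion 3) := by
    refine (FixedPoints.mem_addSubgroup _ _ m).mpr fun d ↦ ?_
    have hd : (d : absoluteGaloisGroup K) ∈ κ.kerSubgroup := (Subgroup.mem_inf.mp d.2).2
    exact (FixedPoints.mem_addSubgroup _ _ m).mp hm ⟨(d : absoluteGaloisGroup K), hd⟩
  rw [h] at hmem
  exact hmem

/-- **`E(K)[3^∞] = 0` on the cell** (in particular `E(K)[3] = 0`, the input of the Kolyvagin-system bound of
STUB A): a point of `E_K[3^∞]` fixed by the whole Galois group `Γ_K` is fixed by `ker κ` for any `ℤ₃`-extension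
`κ` (the cyclotomic one exists), hence zero. [cite: Gross1991, §2 (E(K)[p] = 0 in Kolyvagin's argument)] [cite: Castella2018Erratum, Lemma 2.1] -/
theorem cell_geomPrimaryTorsion_eq_zero_of_fixed :
    ∀ (W : WeierstrassCurve ℚ) [W.IsElliptic] [W.IsGloballyMinimal] (N : ℕ) [NeZero N] (K : Type) [Field K]
      [NumberField K], Summit.BirchSwinnertonDyer.Rank1Residual.Additive.ClassO6 W 3 →
      (∃ Φ : AddSubgroup (WeierstrassCurve.geomTorsion W ((3 : ℕ) : ℤ)),
        Literature.NumberTheory.EllipticCurves.Rank1Residual.IsRationalLine W 3 Φ ∧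
        ∀ (v : IsDedekindDomain.HeightOneSpectrum (NumberField.RingOfIntegers ℚ)),
          ((3 : ℕ) : NumberField.RingOfIntegers ℚ) ∈ v.asIdeal → ∀ 𝔓 ∈ v.primesAbove,
          ¬ (∀ g ∈ 𝔓.decompositionSubgroup (Field.absoluteGaloisGroup ℚ), ∀ P ∈ Φ, g • P = P) ∧
          ¬ (∀ g ∈ 𝔓.decompositionSubgroup (Field.absoluteGaloisGroup ℚ),
              ∀ P : WeierstrassCurve.geomTorsion W ((3 : ℕ) : ℤ), g • P - P ∈ Φ)) →
      W.conductorNorm ℤ = N → Literature.NumberTheory.EllipticCurves.IsImaginaryQuadratic K →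
      Literature.NumberTheory.EllipticCurves.SatisfiesHeegnerHypothesis N K →
      ∀ (κ : Literature.NumberTheory.EllipticCurves.ZpExtension K 3),
      haveI : (W.baseChange K).IsElliptic := inferInstanceAs (W.map (algebraMap ℚ K)).IsElliptic
      ∀ m : (W.baseChange K).geomPrimaryTorsion 3, (∀ g : absoluteGaloisGroup K, g • m = m) → m = 0 := by
  intro W _ _ N _ K _ _ hO6 hline hN hK hHg κ
  haveI : Fact (Nat.Prime 3) := ⟨Nat.prime_three⟩
  haveI hEK : (W.baseChange K).IsElliptic := inferInstanceAs (W.map (algebraMap ℚ K)).IsElliptic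
  intro m hm
  have h := cell_fixedPoints_kerSubgroup_eq_bot W N K hO6 hline hN hK hHg κ
  have hmem : m ∈ FixedPoints.addSubgroup ↥κ.kerSubgroup ((W.baseChange K).geomPrimaryTorsion 3) :=
    (FixedPoints.mem_addSubgroup _ _ m).mpr fun d ↦ hm d
  rw [h] at hmem
  exact hmem

end Summit.BirchSwinnertonDyer.BirchSwinnertonDyer.Theorems.CumulativeHeegnerInclusionAtThreeCellNoThreeTorsion

end
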